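import Summits.HodgeConjecture.CorCM.ImaginaryQuadraticHalfSystems
import Summits.HodgeConjecture.CorCM.GaloisRankTableCertificates
import HarnessLib

/-!
# A balanced set on the Galois group moved by complex conjugation makes a CM type degenerate; primitive degenerate
# CM types from a subgroup `V` of `Gal(K/k)`, `k` an imaginary quadratic subfield

COR-CM (cell `pub-hodgecm2`), binder seat b04 (gen 19), count-neutral claim GALOIS-TWICE-ODD, part III (the field
dress of parts I–II, `TransversalAvoidingTranslate`, `ImaginaryQuadraticHalfSystems`).  KERNEL ONLY: theorems; no
definition, no named fact, no `sorry`.  `HC_CM` is neither used nor claimed.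

SETTING.  `K/ℚ` a Galois CM field, `G = Gal(K/ℚ)`, `c ∈ G` complex conjugation (central, `GaloisOctic`), base
embedding `φ₀`, embeddings `σ_g = φ₀ ∘ g⁻¹` (`embOf`); a CM type `Φ` is read on `G` as `S = {g | σ_g ∈ Φ}`, and
`τ ∈ Aut(ℂ)` with `τ ∘ φ₀ = φ₀ ∘ γ` acts by `σ_g ↦ σ_{g γ⁻¹}` — the translates of `Φ` are the RIGHT translates of `S`.

* §1 **`not_isNondegenerate_of_galois_balanced`**: a finset `D ⊆ G` with `2·#{x ∈ D : x g ∈ S} = #D` for all `g`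
  (Pohlmann's condition (9.2.1) for the multiset `{σ_x : x ∈ D}` against every translate of `Φ`) which is NOT stable
  under `x ↦ c x` makes `Φ` DEGENERATE — the weight `𝟙_{σ(D)}` is balanced but not conjugation-invariant, against
  the tree's `IsNondegenerate.symm_of_isBalanced` (White/Pohlmann: nondegenerate ⟹ balanced weights are symmetric).
* §2 **`exists_isPrimitive_not_isNondegenerate_of_subgroup`**: `H ≤ G` with `c ∉ H`, `G = H ∪ cH`; `V ≤ H` with
  `3 ≤ |V|`; `y₀ ∈ H ∖ V` with `y₀² ≠ 1` ⟹ `K` has a PRIMITIVE DEGENERATE CM type (the half system of a right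
  transversal of `V` with trivial stabiliser, part II, read by `GaloisTable.exists_isPrimitive_of_tableModel`), and
  (`exists_simple_degenerate_of_subgroup`) a SIMPLE CM abelian variety of dimension `[K:ℚ]/2` with an exceptional
  Hodge class on some power.
* §3 **`exists_isPrimitive_not_isNondegenerate_of_quadratic`**: the same with `H = Gal(K/k)` for an intermediate
  field `k` of degree `2` with a complex place (an imaginary quadratic subfield): `[G : H] = 2`, `c ∉ H`.

## References

* [Dodson1984] B. Dodson, *The structure of Galois groups of CM-fields*, Trans. AMS 283 (1984), §3.1.1.
* [Gordon1999HodgeAVSurvey] B. B. Gordon, *A survey of the Hodge conjecture for abelian varieties*, §9.2–9.3, Thm. 6.4.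
* [Shimura1998] G. Shimura, *Abelian Varieties with Complex Multiplication and Modular Functions*, §6.2 Thm. 3,
  §8.1, §8.2 Prop. 26, §18.2 Lemma (i).
* [Kubota1965] T. Kubota, *On the field extension by complex multiplication*, Trans. AMS 118 (1965), §2.
-/

noncomputable section

open CategoryTheory CategoryTheory.Limits NumberField
open scoped BigOperators

namespace Summit.HodgeConjecture.CorCM.TwiceOdd

open Literature.NumberTheory.ComplexMultiplication
open Literature.AlgebraicGeometry.Motives (AbelianVariety CMType)
open Literature.AlgebraicGeometry.HodgeTheory
open Literature.AlgebraicGeometry.ComplexMultiplication (IsCMTypeRealisation isSimple_iff_isPrimitive)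
open Literature.AlgebraicGeometry.Pohlmann1968
open Literature.Barriers.HodgeConjecture (divisorClassesSpan)
open Summit.HodgeConjecture.CorCM.GaloisOctic (embOf_complexConj_mul complexConj_mul_comm complexConj_mul_self
  complexConj_not_mem_fixingSubgroup)
open Summit.HodgeConjecture.CorCM.AbelianSixteen (exists_simple_realisation_of_isPrimitive)

open scoped Classical

variable {K : Type} [Field K] [NumberField K] [IsCMField K]

/-! ## §1 Balanced sets on the Galois group -/

/-- **A balanced finset on `Gal(K/ℚ)` that complex conjugation moves makes the CM type degenerate.**  `K/ℚ` Galois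
CM, `S = {g | σ_g ∈ Φ}`; if `D ⊆ Gal(K/ℚ)` satisfies `2·#{x ∈ D : x g ∈ S} = #D` for every `g` and `c x ∉ D` for
some `x ∈ D`, then `Φ` is NOT nondegenerate: the weight `s ↦ [s ∈ σ(D)]` satisfies Pohlmann's condition against
every `Aut(ℂ)`-translate of `Φ` but is not conjugation-invariant. [cite: Gordon1999HodgeAVSurvey, §9.3]
[cite: Dodson1984, §3.1.1] -/
theorem not_isNondegenerate_of_galois_balanced [IsGalois ℚ K] (Φ : CMType K) (φ₀ : K →+* ℂ)
    (S : Finset (K ≃ₐ[ℚ] K)) (hS : ∀ g, g ∈ S ↔ embOf φ₀ g ∈ Φ.1) (D : Finset (K ≃ₐ[ℚ] K))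
    (hbal : ∀ g : K ≃ₐ[ℚ] K, 2 * (D.filter fun x => x * g ∈ S).card = D.card)
    (hmov : ∃ x ∈ D, (IsCMField.complexConj K).restrictScalars ℚ * x ∉ D) : ¬ IsNondegenerate Φ := by
  intro hnd
  have hinj : Function.Injective (embOf φ₀) := (embOf_bijective φ₀).1
  -- the weight `𝟙_{σ(D)}`
  let f : (K →+* ℂ) → ℚ := fun s => if ∃ x ∈ D, embOf φ₀ x = s then 1 else 0
  have hf : ∀ x, f (embOf φ₀ x) = if x ∈ D then 1 else 0 := by
    intro x
    by_cases hx : x ∈ D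
    · simp only [f, if_pos hx]
      rw [if_pos ⟨x, hx, rfl⟩]
    · simp only [f, if_neg hx]
      rw [if_neg]
      rintro ⟨x', hx', h⟩
      exact hx (hinj h ▸ hx')
  -- it is balanced
  have hbalf : IsBalanced (ℂ ≃+* ℂ) Φ.1 f := by
    intro τ
    obtain ⟨γ, hγ⟩ := exists_algEquiv_comp_eq_smul φ₀ τ
    let e : (K ≃ₐ[ℚ] K) ≃ (K →+* ℂ) := Equiv.ofBijective _ (embOf_bijective φ₀)
    have he : ∀ x, e x = embOf φ₀ x := fun _ => rfl
    have h1 : ∑ s, f s * translateInd Φ.1 τ s = ((D.filter fun x => x * γ⁻¹ ∈ S).card : ℚ) := by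
      rw [← Equiv.sum_comp e]
      have hterm : ∀ x, f (e x) * translateInd Φ.1 τ (e x) = if x ∈ D ∧ x * γ⁻¹ ∈ S then 1 else 0 := by
        intro x
        rw [he, hf]
        have ht : translateInd Φ.1 τ (embOf φ₀ x) = if x * γ⁻¹ ∈ S then 1 else 0 := by
          by_cases h : x * γ⁻¹ ∈ S
          · rw [if_pos h, translateInd_of_mem (by rw [smul_embOf_of_comp φ₀ hγ]; exact (hS _).1 h)]
          · rw [if_neg h, translateInd_of_not_mem (by rw [smul_embOf_of_comp φ₀ hγ]; exact fun h' => h ((hS _).2 h'))]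
        rw [ht, ite_zero_mul_ite_zero, one_mul]
      simp_rw [hterm]
      rw [Finset.sum_boole]
      congr 2
      ext x
      simp
    have h2 : ∑ s, f s = (D.card : ℚ) := by
      rw [← Equiv.sum_comp e]
      simp_rw [he, hf]
      rw [Finset.sum_boole]
      congr 2
      ext x
      simp
    rw [h1, h2]
    exact_mod_cast hbal γ⁻¹
  -- but not conjugation-invariant
  obtain ⟨x, hxD, hcx⟩ := hmov
  have hsym := hnd.symm_of_isBalanced hbalf (embOf φ₀ x)
  rw [← embOf_complexConj_mul, hf, hf, if_neg hcx, if_pos hxD] at hsym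
  exact zero_ne_one hsym

/-! ## §2 Primitive degenerate CM types from a subgroup `V ≤ H`, `[G : H] = 2`, `c ∉ H` -/

/-- **`H ≤ Gal(K/ℚ)` with `c ∉ H` and `G = H ∪ cH`, `V ≤ H` with `3 ≤ |V|`, a non-involution `y₀ ∈ H ∖ V` ⟹ a
PRIMITIVE DEGENERATE CM type of `K`** (`K/ℚ` Galois CM).  The type is the half system `N ∪ c(H ∖ N)` of a right
transversal `N` of `V` in `H` with trivial left stabiliser (parts I–II): primitive by Shimura's criterion, degenerate
by the balanced set `V ∪ c V y₀` (§1). [cite: Shimura1998, §8.2 Prop. 26] [cite: Dodson1984, §3.1.1]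
[cite: Gordon1999HodgeAVSurvey, §9.3] -/
theorem exists_isPrimitive_not_isNondegenerate_of_subgroup [IsGalois ℚ K] (H V : Subgroup (K ≃ₐ[ℚ] K))
    (hcH : (IsCMField.complexConj K).restrictScalars ℚ ∉ H)
    (hH : ∀ g : K ≃ₐ[ℚ] K, g ∈ H ∨ (IsCMField.complexConj K).restrictScalars ℚ * g ∈ H) (hVH : V ≤ H)
    (h3 : 3 ≤ Nat.card V) {y₀ : K ≃ₐ[ℚ] K} (hy₀H : y₀ ∈ H) (hy₀V : y₀ ∉ V) (hy₀2 : y₀ * y₀ ≠ 1)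
    (φ₀ : K →+* ℂ) : ∃ Φ : CMType K, IsPrimitive (ℂ ≃+* ℂ) Φ.1 φ₀ ∧ ¬ IsNondegenerate Φ := by
  set c : K ≃ₐ[ℚ] K := (IsCMField.complexConj K).restrictScalars ℚ with hc_def
  obtain ⟨S, D, hcm, hstab, hbal, h1D, hcD, -⟩ := exists_halfSystem_of_subgroup (c := c) complexConj_mul_self
    (fun g => complexConj_mul_comm g) hcH hH hVH h3 hy₀H hy₀V hy₀2
  obtain ⟨Φ, hprim, hread⟩ := GaloisTable.exists_isPrimitive_of_tableModel (K := K) (X := K ≃ₐ[ℚ] K)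
    (fun a b => a * b) (Equiv.refl _) (fun _ _ => rfl) c rfl 1 rfl S hcm hstab φ₀
  refine ⟨Φ, hprim, not_isNondegenerate_of_galois_balanced Φ φ₀ S (fun g => ?_) D hbal ⟨1, h1D, ?_⟩⟩
  · simpa using hread g
  · rw [mul_one]; exact hcD

/-- **… realised: a SIMPLE DEGENERATE CM abelian variety of dimension `[K:ℚ]/2`** (Shimura's existence theorem and
"simple ⟺ primitive"), carrying on some power a rational `(p,p)` class outside the complexified divisor ring
(Hazama/Pohlmann). [cite: Shimura1998, §6.2 Thm. 3 and §8.2 Prop. 26] [cite: Gordon1999HodgeAVSurvey, Thm. 6.4] -/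
theorem exists_simple_degenerate_of_subgroup [IsGalois ℚ K] (H V : Subgroup (K ≃ₐ[ℚ] K))
    (hcH : (IsCMField.complexConj K).restrictScalars ℚ ∉ H)
    (hH : ∀ g : K ≃ₐ[ℚ] K, g ∈ H ∨ (IsCMField.complexConj K).restrictScalars ℚ * g ∈ H) (hVH : V ≤ H)
    (h3 : 3 ≤ Nat.card V) {y₀ : K ≃ₐ[ℚ] K} (hy₀H : y₀ ∈ H) (hy₀V : y₀ ∉ V) (hy₀2 : y₀ * y₀ ≠ 1) :
    ∃ (Φ : CMType K) (φ₀ : K →+* ℂ) (A : AbelianVariety ℂ) (ι : 𝓞 K →+* End A)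
      (θ : K →+* Module.End ℂ (complexBetti A.X 1)),
      IsPrimitive (ℂ ≃+* ℂ) Φ.1 φ₀ ∧ ¬ IsNondegenerate Φ ∧ IsCMTypeRealisation Φ A ι θ ∧ A.IsSimple ∧
      A.dim = Module.finrank ℚ K / 2 ∧
      ∃ n p : ℕ, ∃ x : complexBetti (⨁ fun _ : Fin n => A).X (2 * p), IsRationalClass x ∧
        IsOfHodgeType (⨁ fun _ : Fin n => A).dim (⨁ fun _ : Fin n => A).X (2 * p) p p x ∧
        x ∉ divisorClassesSpan (⨁ fun _ : Fin n => A).X (⨁ fun _ : Fin n => A).dim p := by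
  obtain ⟨φ₀⟩ := (inferInstance : Nonempty (K →+* ℂ))
  obtain ⟨Φ, hprim, hdeg⟩ :=
    exists_isPrimitive_not_isNondegenerate_of_subgroup H V hcH hH hVH h3 hy₀H hy₀V hy₀2 φ₀
  obtain ⟨A, ι, θ, hA, hs, hdim⟩ := exists_simple_realisation_of_isPrimitive Φ φ₀ hprim
  exact ⟨Φ, φ₀, A, ι, θ, hprim, hdeg, hA, hs, hdim, exists_exceptional_pow_of_not_isNondegenerate φ₀ hprim hdeg hA⟩

/-! ## §3 `H = Gal(K/k)` for an imaginary quadratic subfield `k` -/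

/-- For an intermediate field `k` of degree `2` with a complex place (`K/ℚ` Galois CM): `c ∉ Gal(K/k)` and
`Gal(K/ℚ) = Gal(K/k) ∪ c·Gal(K/k)` (`[Gal(K/ℚ) : Gal(K/k)] = [k : ℚ] = 2`). [folklore] -/
theorem mem_or_complexConj_mul_mem_of_quadratic [IsGalois ℚ K] (k : IntermediateField ℚ K)
    (hk : Module.finrank ℚ k = 2) (τ₀ : k →+* ℂ) (hτ₀ : ComplexEmbedding.conjugate τ₀ ≠ τ₀) :
    (IsCMField.complexConj K).restrictScalars ℚ ∉ k.fixingSubgroup ∧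
      ∀ g : K ≃ₐ[ℚ] K, g ∈ k.fixingSubgroup ∨ (IsCMField.complexConj K).restrictScalars ℚ * g ∈ k.fixingSubgroup := by
  have hcH := complexConj_not_mem_fixingSubgroup k τ₀ hτ₀
  refine ⟨hcH, fun g => ?_⟩
  -- index `2`
  have hidx : k.fixingSubgroup.index = 2 := by
    have h1 := k.fixingSubgroup.index_mul_card
    rw [IsGalois.card_fixingSubgroup_eq_finrank k, IsGalois.card_aut_eq_finrank] at h1
    have h2 := Module.finrank_mul_finrank ℚ k K
    rw [hk] at h2
    have hpos : 0 < Module.finrank k K := Module.finrank_pos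
    have : k.fixingSubgroup.index * Module.finrank (↥k) K = 2 * Module.finrank (↥k) K := by rw [h1, h2]
    exact Nat.eq_of_mul_eq_mul_right hpos this
  by_cases hg : g ∈ k.fixingSubgroup
  · exact Or.inl hg
  · right
    rw [Subgroup.mul_mem_iff_of_index_two hidx]
    exact ⟨fun h => (hcH h).elim, fun h => (hg h).elim⟩

/-- **Imaginary quadratic subfield version.**  `K/ℚ` Galois CM, `k ⊆ K` of degree `2` with a complex place,
`V ≤ Gal(K/k)` with `3 ≤ |V|`, and a non-involution `y₀ ∈ Gal(K/k) ∖ V` ⟹ a PRIMITIVE DEGENERATE CM type of `K`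
(⟹ a simple degenerate CM abelian variety, `exists_simple_degenerate_of_subgroup`).  For `[K : k]` odd every
`y₀ ∉ V` qualifies and `V` can be any proper subgroup `≠ 1` (part IV). [cite: Dodson1984, §3.1.1]
[cite: Shimura1998, §8.2 Prop. 26] [cite: Gordon1999HodgeAVSurvey, §9.3] -/
theorem exists_isPrimitive_not_isNondegenerate_of_quadratic [IsGalois ℚ K] (k : IntermediateField ℚ K)
    (hk : Module.finrank ℚ k = 2) (τ₀ : k →+* ℂ) (hτ₀ : ComplexEmbedding.conjugate τ₀ ≠ τ₀)
    (V : Subgroup (K ≃ₐ[ℚ] K)) (hVH : V ≤ k.fixingSubgroup) (h3 : 3 ≤ Nat.card V) {y₀ : K ≃ₐ[ℚ] K}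
    (hy₀H : y₀ ∈ k.fixingSubgroup) (hy₀V : y₀ ∉ V) (hy₀2 : y₀ * y₀ ≠ 1) (φ₀ : K →+* ℂ) :
    ∃ Φ : CMType K, IsPrimitive (ℂ ≃+* ℂ) Φ.1 φ₀ ∧ ¬ IsNondegenerate Φ := by
  obtain ⟨hcH, hH⟩ := mem_or_complexConj_mul_mem_of_quadratic k hk τ₀ hτ₀
  exact exists_isPrimitive_not_isNondegenerate_of_subgroup k.fixingSubgroup V hcH hH hVH h3 hy₀H hy₀V hy₀2 φ₀

end Summit.HodgeConjecture.CorCM.TwiceOdd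

end
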